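import Literature.MathematicalPhysics.QuantumFieldTheory.BalabanImbrieJaffe1984to88.BIJ88Restr592Proof
import Literature.MathematicalPhysics.QuantumFieldTheory.BalabanImbrieJaffe1984to88.BIJ88Regularity286

/-!
# `BalabanImbrieJaffe1984to88.BIJ88PassageMechanism593` — T. Bałaban, J. Imbrie, A. Jaffe, *Effective action and cluster
properties of the abelian Higgs model*, Commun. Math. Phys. **114** (1988) 257–315 [BalabanImbrieJaffe1988]:
p. 296 [PDF 40], inside the proof of **(5.9.3)**, verbatim *"In going from u_k to u_{k+1} we made a gauge transformation and removed
some small fields. Also, the gauge transformation was not quite compensated by a rotation of ψ. Thus in going from the old |D_{ū_k}ψ|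
to the new |D_{ū_{k+1}}ψ| we make errors of the order of …"* — the two PROSE MECHANISMS of the passage PROVED on the S3 carrier of
p36's `BIJ88Ineq593Proof` (fine `η`-lattice bond field `u`, coarse bonds `b` with the straight contour `line b` from `base b₋` to
`base b₊`, `ū(b) = transport u (line b)`, `(D_ūψ)(b) = covD 1 ū ψ b`), refining p02 g6's `BIJ88Restr592Proof.norm_covD_le_add_defect`
(where the defect `|ū_{k+1}(b) − ū_k(b)|` was a datum) — kind «mechanism / kernel lemma» for row **C2.Eq5.9.3**; theorems only.

statement-level skeleton of published theorems with citation tags; proofs where landed; nothing here is a claim about the Yang–Mills mass gap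

PDF held: `paper:balaban1988-cmp114-bij-abelian-higgs-effective-action` (journal page = PDF page + 256); p. 296 [PDF 40] read this
session from the text layer; (5.6.6) p. 287 (the removed small field `ũ = exp ie_kη[θ_kH_{k,loc}A^{(k)} + w₁A′]`, r16's
`BIJ88Sect5StatementsPart3.uSmall566`), (4.16) p. 276 (gauge transformations, r18's `gaugeU`/`gaugePhi`/`covD_gauge`/`transport_gauge`).

CITATION HEADER (lean-in-tree rule).  Part of the lit-balaban TYPED SKELETON (HOME `run/shared/lean/pub/lit-balaban/`), Phase 2,
seat p02 gen 7 (unit `lit-balaban-p02`); row **C2.Eq5.9.3** of `HOME/lit-balaban-r16/ROWS-C2-part2.md` (fold owner r16: *"(5.9.3) is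
proved modulo the single prose datum |ū_{k+1}(b) − ū_k(b)| ≤ c₁e_kp(e_k)²"*, 19:17Z).  WHAT IS PROVED HERE (0 `sorry`, standard axioms,
no definitions, no named facts):
* §1 abelian transport algebra on r18's `transport`/`phaseCfg`/`signedSum`: `transport_mul` (`(uw)(Γ) = u(Γ)w(Γ)`), `transport_phaseCfg`
  (`e^{iθ}(Γ) = e^{iΣ_Γ±θ}`), `abs_signedSum_le` (`|Σ_Γ±θ| ≤ |Γ|·K` if `|θ| ≤ K` on `Γ`);
* §2 «removed some small fields»: `norm_transport_mul_phase_sub_le` — for unit-modulus `u`, `|\overline{u·e^{iθ}}(b) − ū(b)| ≤ |Σ_{line b}±θ|`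
  (via Mathlib's `|e^{it} − 1| ≤ |t|`);
* §3 «a gauge transformation … compensated by a rotation of ψ»: `avg_gaugeU` — averaging COMMUTES with gauge transformations along a
  lattice curve, `\overline{u^λ}(b) = (ū)^{λ∘base}(b)` (r18's `transport_gauge`), and `norm_covD_gauge_rotate` — rotating `ψ` by `λ∘base`
  compensates EXACTLY: `|D_{ū^{λ∘base}}ψ^{λ∘base}(b)| = |D_ūψ(b)|` (r18's `covD_gauge`);
* §4 «not quite compensated» + «removed some small fields» together: **`passage593_mechanism`** — with the new fine field
  `u′ = (u·e^{iθ})^λ`, the new coarse field `ū′(b) = u′(line b)` and the new block field `ψ′ = e^{i(λ∘base + μ)}ψ` (rotation by `λ` at the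
  base points up to a residual `μ`): `|D_{ū′}ψ′(b)| ≤ |D_ūψ(b)| + (|Σ_{line b}±θ| + |μ(b₊) − μ(b₋)|)·|ψ(b₊)|` — p02 g6's error STRUCTURE
  with the defect now DERIVED: `δ(b) = |Σ_{line b}±θ| + |μ(b₊) − μ(b₋)|`;
* §5 the printed SIZE: **`passage593_datum`** — per-bond smallness `|θ| ≤ e_kηK` on the `≤ n_ℓ` bonds of the line (the removed /
  translation fields are `e_kη·[fields ≤ cp(e_k)]`: (5.6.6) with (5.9.4) `|A^{(k)}| ≤ cp(e_k)`, (5.3.1) `|A′| ≤ cp(e_k)`, (2.5), (5.4.7)),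
  `η·n_ℓ ≤ ℓ₀` (the line has length O(1)) and a rotation residual `|μ(b₊) − μ(b₋)| ≤ e_kM·p(e_k)` give
  `δ(b) ≤ (ℓ₀K + M)·e_k·p(e_k) ≤ (ℓ₀K + M)·e_k·p(e_k)²` (`p(e_k) ≥ 1`) — the datum shape `c₁e_kp(e_k)²` of `passage593_order` /
  `BIJ88Ineq593Model.ineq593_model`; `passage593_mechanism_datum` combines §4 and §5.
* §6 (v1.1) ON r16's TYPED FORMS: `bgExp_eq_mul_phaseCfg` (two background forms `(Q^{s*}_{k+1}v)e^{ie_kηX}` with the same block part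
  differ by the phase field of the bracket difference), `uSmall566_eq_phaseCfg` ((5.6.6) `ũ` is a `phaseCfg`), `uTilde561_eq_mul_phaseCfg`
  ((5.6.1) `ũ_{k+1} = u_k·e^{ie_kη(bracket561 − X_k)}` against (5.3.4) `u_k = (Q^{s*}_{k+1}v)e^{ie_kηX_k}`), `passage593_mechanism₀` (λ = 0, via
  p31's `BIJ88Regularity286.gaugeU_zero`),
  **`passage593_mechanism_typed`** (the mechanism with old field (5.3.4) and new field (5.6.1): the removed small fields IDENTIFIED as
  `e_kη[(1−θ_k)H_{k,loc}A^{(k)} − L^{−2}𝒟^η_{k+1,loc}∂*Q^{e*}_{k+1}f − X_k]` per bond), `abs_removedPhase_le` (their per-bond size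
  `≤ e_kη(K₁ + L^{−2}K₂ + K₃)p(e_k)` from `|H_{k,loc}A^{(k)}| ≤ K₁p(e_k)`, `|𝒟…f| ≤ K₂p(e_k)`, `|X_k| ≤ K₃p(e_k)`, `0 ≤ θ_k ≤ 1`),
  `passage593_datum'` (the datum with `p(e_k)`-proportional per-bond bounds).
READINGS (declared): what is NOT identified here is the gauge function `λ` of Sect. 5.4 (absorbed: p. 286 *"Q^{s*}_k e^{ie_kηλ} is a …
gauge transformation … so we can delete it from u_k"*, whence λ = 0 in §6) and the rotation residual `μ` (the print's *"not quite
compensated"*, a datum `|μ(b₊) − μ(b₋)| ≤ e_kM·p(e_k)`); the torus instances of `Q^{s*}_{k+1}v`, `H_{k,loc}A^{(k)}`, `𝒟…f`, `X_k` with their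
bounds live on the carriers of rows C2.Eq5.3.x–5.6.x.  No Summits import.
-/

namespace Literature.MathematicalPhysics.QuantumFieldTheory.BalabanImbrieJaffe1984to88.BIJ88PassageMechanism593

open Literature.MathematicalPhysics.QuantumFieldTheory.Balaban1983to89
open BIJ88Sect3Statements BIJ88Sect5StatementsPart4 BIJ88Ineq593Proof BIJ88Restr592Proof
open Complex

variable {P : Params} {j j' : ℕ}

/-! ## §1 Abelian transport algebra -/

section Algebra

/-- the transport of a pointwise PRODUCT of bond fields is the product of the transports (the structure group `U(1)` is
abelian; complex conjugation is multiplicative). [cite: BalabanImbrieJaffe1988, (1.1) p.258] -/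
theorem transport_mul (u w : PBond P j → ℂ) :
    ∀ γ : Contour P j, transport (fun b => u b * w b) γ = transport u γ * transport w γ
  | [] => by simp
  | s :: γ => by
    rw [transport_cons, transport_cons, transport_cons, transport_mul u w γ]
    split_ifs
    · ring
    · rw [map_mul]; ring

/-- the transport of a pure phase field `e^{iθ}` is `e^{iΣ_Γ ±θ}` (r18's `loopVar_phase`, restated for `transport`).
[cite: BalabanImbrieJaffe1988, (1.1) p.258] -/
theorem transport_phaseCfg (θ : PBond P j → ℝ) (γ : Contour P j) :
    transport (phaseCfg θ) γ = exp ((signedSum θ γ : ℂ) * I) :=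
  loopVar_phase θ γ

/-- `|Σ_Γ ±θ| ≤ |Γ|·K` when `|θ| ≤ K` on the bonds of `Γ`. [cite: BalabanImbrieJaffe1988, (1.1) p.258] -/
theorem abs_signedSum_le (θ : PBond P j → ℝ) {K : ℝ} :
    ∀ γ : Contour P j, (∀ sg ∈ γ, |θ sg.1| ≤ K) → |signedSum θ γ| ≤ γ.length * K
  | [], _ => by simp [signedSum]
  | s :: γ, h => by
    have hs : |θ s.1| ≤ K := h s (by simp)
    have ih : |signedSum θ γ| ≤ γ.length * K := abs_signedSum_le θ γ fun sg hsg => h sg (by simp [hsg])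
    have hcons : signedSum θ (s :: γ) = (if s.2 then θ s.1 else -θ s.1) + signedSum θ γ := by
      simp [signedSum]
    rw [hcons, List.length_cons, Nat.cast_succ]
    have h1 : |(if s.2 then θ s.1 else -θ s.1)| ≤ K := by split_ifs <;> simp [abs_neg, hs]
    calc |(if s.2 then θ s.1 else -θ s.1) + signedSum θ γ| ≤ |(if s.2 then θ s.1 else -θ s.1)| + |signedSum θ γ| :=
        abs_add_le _ _
      _ ≤ K + γ.length * K := add_le_add h1 ih
      _ = (γ.length + 1) * K := by ring

end Algebra

/-! ## §2 «and removed some small fields»: a small multiplicative field moves the coarse bond variable by at most its summed phase -/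

section SmallField

/-- **«removed some small fields»**: for a unit-modulus fine field `u` and a real bond field `θ` (the removed field is `e^{iθ}`, e.g.
(5.6.6) `ũ = exp ie_kη[θ_kH_{k,loc}A^{(k)} + w₁A′]`), the coarse bond variables of `u·e^{iθ}` and of `u` along the same contour differ by
at most the summed phase: `|\overline{u e^{iθ}}(b) − ū(b)| ≤ |Σ_{line b} ±θ|`. [cite: BalabanImbrieJaffe1988, (5.9.3) p.296] -/
theorem norm_transport_mul_phase_sub_le (u : PBond P j → ℂ) (hu : ∀ b, ‖u b‖ = 1) (θ : PBond P j → ℝ) (γ : Contour P j) :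
    ‖transport (fun b => u b * phaseCfg θ b) γ - transport u γ‖ ≤ |signedSum θ γ| := by
  rw [transport_mul, transport_phaseCfg]
  have h : transport u γ * exp ((signedSum θ γ : ℂ) * I) - transport u γ
      = transport u γ * (exp ((signedSum θ γ : ℂ) * I) - 1) := by ring
  rw [h, norm_mul, norm_transport u hu γ, one_mul, mul_comm]
  -- `|e^{it} − 1| ≤ |t|` (Mathlib; the `exp(t·I)` spelling is the tree's `Literature.Topology.FourManifolds.MMSW.norm_exp_mul_I_sub_one_le`)
  exact Real.norm_exp_I_mul_ofReal_sub_one_le.trans (le_of_eq (Real.norm_eq_abs _))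

/-- … hence, with `|θ| ≤ K` on the `≤ n` bonds of the contour, `|\overline{u e^{iθ}}(b) − ū(b)| ≤ n·K`. [cite: BalabanImbrieJaffe1988, (5.9.3) p.296] -/
theorem norm_transport_mul_phase_sub_le_of_bound (u : PBond P j → ℂ) (hu : ∀ b, ‖u b‖ = 1) (θ : PBond P j → ℝ)
    (γ : Contour P j) {K : ℝ} {n : ℕ} (hK : 0 ≤ K) (hθ : ∀ sg ∈ γ, |θ sg.1| ≤ K) (hn : γ.length ≤ n) :
    ‖transport (fun b => u b * phaseCfg θ b) γ - transport u γ‖ ≤ n * K :=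
  (norm_transport_mul_phase_sub_le u hu θ γ).trans ((abs_signedSum_le θ γ hθ).trans
    (mul_le_mul_of_nonneg_right (by exact_mod_cast hn) hK))

end SmallField

/-! ## §3 «we made a gauge transformation … compensated by a rotation of ψ» -/

section Gauge

/-- AVERAGING COMMUTES WITH GAUGE TRANSFORMATIONS: along a lattice curve from `base b₋` to `base b₊` the coarse bond variable of
the gauge-transformed fine field is the gauge transform, by `λ∘base`, of the coarse bond variable — `\overline{u^λ}(b) =
e^{iλ(base b₋)} ū(b) e^{−iλ(base b₊)} = (ū)^{λ∘base}(b)` (r18's telescoping `transport_gauge`). [cite: BalabanImbrieJaffe1988, (4.16) p.276] -/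
theorem avg_gaugeU (lam : Balaban1983to89.Site P j → ℝ) (u : PBond P j → ℂ) (base : Balaban1983to89.Site P j' → Balaban1983to89.Site P j)
    (line : PBond P j' → Contour P j) (b : PBond P j') (hline : IsPath (base b.src) (line b) (base b.tgt)) :
    transport (gaugeU lam u) (line b) = gaugeU (lam ∘ base) (fun b' => transport u (line b')) b := by
  rw [transport_gauge lam u (line b) (base b.src) (base b.tgt) hline]
  rfl

/-- EXACT COMPENSATION: rotating the block field by the gauge function at the base points, `ψ ↦ e^{iλ(base ·)}ψ`, compensates the
gauge transformation of the coarse bond variables exactly — `|D_{(ū)^{λ∘base}}(e^{iλ∘base}ψ)(b)| = |D_ūψ(b)|` (r18's `covD_gauge`).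
[cite: BalabanImbrieJaffe1988, (4.16) p.276] -/
theorem norm_covD_gauge_rotate (lam' : Balaban1983to89.Site P j' → ℝ) (ubar : PBond P j' → ℂ) (ψ : Balaban1983to89.Site P j' → ℂ)
    (b : PBond P j') : ‖covD 1 (gaugeU lam' ubar) (gaugePhi lam' ψ) b‖ = ‖covD 1 ubar ψ b‖ := by
  rw [covD_gauge, norm_mul, norm_exp_ofReal_mul_I, one_mul]

end Gauge

/-! ## §4 «not quite compensated» and «removed some small fields» together: the error structure with the defect DERIVED -/

section Mechanism

/-- kernel: `|a·e^{it} − 1| ≤ |a − 1| + |t|`. [cite: BalabanImbrieJaffe1988, (5.9.3) p.296] -/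
theorem norm_mul_exp_sub_one_le (a : ℂ) (t : ℝ) : ‖a * exp ((t : ℂ) * I) - 1‖ ≤ ‖a - 1‖ + |t| := by
  have h : a * exp ((t : ℂ) * I) - 1 = (a - 1) * exp ((t : ℂ) * I) + (exp ((t : ℂ) * I) - 1) := by ring
  rw [h]
  refine (norm_add_le _ _).trans (add_le_add ?_ ?_)
  · rw [norm_mul, norm_exp_ofReal_mul_I, mul_one]
  · rw [mul_comm]
    exact Real.norm_exp_I_mul_ofReal_sub_one_le.trans (le_of_eq (Real.norm_eq_abs _))

/-- the ALGEBRA of the passage: with the new fine field `u′ = (u·e^{iθ})^λ`, the new coarse field `ū′(b) = u′(line b)` and the new block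
field `ψ′ = e^{i(λ∘base + μ)}ψ`, one has `D_{ū′}ψ′(b) = e^{i(λ(base b₋) + μ(b₋))} · D_{ū″}ψ(b)` with the EFFECTIVE coarse field
`ū″(b) = ū(b)·e^{iθ}(line b)·e^{i(μ(b₊) − μ(b₋))}`. [cite: BalabanImbrieJaffe1988, (5.9.3) p.296] -/
theorem covD_passage_eq (u : PBond P j → ℂ) (θ : PBond P j → ℝ) (lam : Balaban1983to89.Site P j → ℝ)
    (μ : Balaban1983to89.Site P j' → ℝ) (ψ : Balaban1983to89.Site P j' → ℂ)
    (base : Balaban1983to89.Site P j' → Balaban1983to89.Site P j) (line : PBond P j' → Contour P j) (b : PBond P j')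
    (hline : IsPath (base b.src) (line b) (base b.tgt)) :
    covD 1 (fun b' => transport (gaugeU lam (fun e => u e * phaseCfg θ e)) (line b'))
        (fun z => exp (((lam (base z) + μ z : ℝ) : ℂ) * I) * ψ z) b
      = exp (((lam (base b.src) + μ b.src : ℝ) : ℂ) * I) *
        covD 1 (fun b' => transport u (line b') * transport (phaseCfg θ) (line b') *
          exp (((μ b'.tgt - μ b'.src : ℝ) : ℂ) * I)) ψ b := by
  simp only [covD, Complex.ofReal_one, one_mul]
  rw [transport_gauge lam _ (line b) (base b.src) (base b.tgt) hline, transport_mul]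
  have key : ∀ s t : ℝ, exp (((s : ℝ) : ℂ) * I) * exp (((t : ℝ) : ℂ) * I) = exp (((s + t : ℝ) : ℂ) * I) := by
    intro s t; rw [← Complex.exp_add]; push_cast; ring_nf
  -- expand the sums in the exponents and compare monomials in `exp`
  have e1 : exp (((lam (base b.tgt) + μ b.tgt : ℝ) : ℂ) * I)
      = exp (((lam (base b.tgt) : ℝ) : ℂ) * I) * exp (((μ b.tgt : ℝ) : ℂ) * I) := by rw [key]
  have e2 : exp (((lam (base b.src) + μ b.src : ℝ) : ℂ) * I)
      = exp (((lam (base b.src) : ℝ) : ℂ) * I) * exp (((μ b.src : ℝ) : ℂ) * I) := by rw [key]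
  have e3 : exp (((μ b.tgt - μ b.src : ℝ) : ℂ) * I) * exp (((μ b.src : ℝ) : ℂ) * I) = exp (((μ b.tgt : ℝ) : ℂ) * I) := by
    rw [key]; ring_nf
  have e4 : exp (-(((lam (base b.tgt) : ℝ) : ℂ) * I)) * exp (((lam (base b.tgt) : ℝ) : ℂ) * I) = 1 := by
    rw [← Complex.exp_add]; simp
  rw [e1, e2]
  calc exp (((lam (base b.src) : ℝ) : ℂ) * I) * (transport u (line b) * transport (phaseCfg θ) (line b)) *
          exp (-(((lam (base b.tgt) : ℝ) : ℂ) * I)) *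
          (exp (((lam (base b.tgt) : ℝ) : ℂ) * I) * exp (((μ b.tgt : ℝ) : ℂ) * I) * ψ b.tgt) -
        exp (((lam (base b.src) : ℝ) : ℂ) * I) * exp (((μ b.src : ℝ) : ℂ) * I) * ψ b.src
      = exp (((lam (base b.src) : ℝ) : ℂ) * I) *
          (transport u (line b) * transport (phaseCfg θ) (line b) *
            (exp (-(((lam (base b.tgt) : ℝ) : ℂ) * I)) * exp (((lam (base b.tgt) : ℝ) : ℂ) * I)) *
            exp (((μ b.tgt : ℝ) : ℂ) * I) * ψ b.tgt - exp (((μ b.src : ℝ) : ℂ) * I) * ψ b.src) := by ring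
    _ = exp (((lam (base b.src) : ℝ) : ℂ) * I) *
          (transport u (line b) * transport (phaseCfg θ) (line b) *
            (exp (((μ b.tgt - μ b.src : ℝ) : ℂ) * I) * exp (((μ b.src : ℝ) : ℂ) * I)) * ψ b.tgt -
            exp (((μ b.src : ℝ) : ℂ) * I) * ψ b.src) := by rw [e4, e3, mul_one]
    _ = exp (((lam (base b.src) : ℝ) : ℂ) * I) * exp (((μ b.src : ℝ) : ℂ) * I) *
          (transport u (line b) * transport (phaseCfg θ) (line b) * exp (((μ b.tgt - μ b.src : ℝ) : ℂ) * I) * ψ b.tgt -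
            ψ b.src) := by ring

/-- **THE PASSAGE MECHANISM** (p. 296: *"we made a gauge transformation and removed some small fields. Also, the gauge transformation
was not quite compensated by a rotation of ψ. Thus in going from the old |D_{ū_k}ψ| to the new |D_{ū_{k+1}}ψ| we make errors …"*):
with the fine field `u = u_k` of unit modulus, the new fine field `u′ = (u·e^{iθ})^λ` (gauge transformation `λ`; small multiplicative
field `e^{iθ}`), the coarse fields `ū(b) = u(line b)`, `ū′(b) = u′(line b)` along the straight contour from `base b₋` to `base b₊`, and the
rotated block field `ψ′ = e^{i(λ∘base + μ)}ψ` (rotation by `λ` at the base points up to a residual `μ`):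
`|D_{ū′}ψ′(b)| ≤ |D_ūψ(b)| + (|Σ_{line b} ±θ| + |μ(b₊) − μ(b₋)|)·|ψ(b₊)|` — p02 g6's error structure (`norm_covD_le_add_defect`) with
the defect DERIVED. [cite: BalabanImbrieJaffe1988, (5.9.3) p.296] -/
theorem passage593_mechanism (u : PBond P j → ℂ) (hu : ∀ b, ‖u b‖ = 1) (θ : PBond P j → ℝ)
    (lam : Balaban1983to89.Site P j → ℝ) (μ : Balaban1983to89.Site P j' → ℝ) (ψ : Balaban1983to89.Site P j' → ℂ)
    (base : Balaban1983to89.Site P j' → Balaban1983to89.Site P j) (line : PBond P j' → Contour P j) (b : PBond P j')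
    (hline : IsPath (base b.src) (line b) (base b.tgt)) :
    ‖covD 1 (fun b' => transport (gaugeU lam (fun e => u e * phaseCfg θ e)) (line b'))
        (fun z => exp (((lam (base z) + μ z : ℝ) : ℂ) * I) * ψ z) b‖
      ≤ ‖covD 1 (fun b' => transport u (line b')) ψ b‖ + (|signedSum θ (line b)| + |μ b.tgt - μ b.src|) * ‖ψ b.tgt‖ := by
  rw [covD_passage_eq u θ lam μ ψ base line b hline, norm_mul, norm_exp_ofReal_mul_I, one_mul]
  refine (norm_covD_le_add_defect (fun b' => transport u (line b')) _ ψ b).trans (add_le_add le_rfl ?_)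
  refine mul_le_mul_of_nonneg_right ?_ (norm_nonneg _)
  -- the defect of the effective coarse field
  have hT : ‖transport u (line b)‖ = 1 := norm_transport u hu (line b)
  have h1 : transport u (line b) * transport (phaseCfg θ) (line b) * exp (((μ b.tgt - μ b.src : ℝ) : ℂ) * I)
        - transport u (line b)
      = transport u (line b) * (transport (phaseCfg θ) (line b) * exp (((μ b.tgt - μ b.src : ℝ) : ℂ) * I) - 1) := by ring
  rw [h1, norm_mul, hT, one_mul]
  refine (norm_mul_exp_sub_one_le _ _).trans (add_le_add ?_ le_rfl)
  rw [transport_phaseCfg, mul_comm]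
  exact Real.norm_exp_I_mul_ofReal_sub_one_le.trans (le_of_eq (Real.norm_eq_abs _))

end Mechanism

/-! ## §5 The printed size of the defect from per-bond data: `δ ≤ c₁e_kp(e_k) ≤ c₁e_kp(e_k)²` -/

section Datum

/-- **the datum shape DERIVED**: if the removed / translation phases are `e_kη`-small per bond, `|θ| ≤ e_kηK` on the `≤ n_ℓ` bonds of
the line ((5.6.6) `e_kη[θ_kH_{k,loc}A^{(k)} + w₁A′]` with (5.9.4), (5.3.1), (2.5), (5.4.7)), the line has length O(1) in lattice units,
`η·n_ℓ ≤ ℓ₀`, and the rotation residual obeys `|μ(b₊) − μ(b₋)| ≤ e_kM·p(e_k)`, then the defect coefficient of `passage593_mechanism` is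
`≤ (ℓ₀K + M)·e_k·p(e_k) ≤ (ℓ₀K + M)·e_k·p(e_k)²` (`p(e_k) ≥ 1`) — the shape `c₁e_kp(e_k)²` taken as data by p02 g6's `passage593_order`.
[cite: BalabanImbrieJaffe1988, (5.9.3) p.296] -/
theorem passage593_datum (θ : PBond P j → ℝ) (γ : Contour P j) {ek η K ℓ₀ M pek Δμ : ℝ} {nℓ : ℕ} (hek : 0 ≤ ek) (hη : 0 ≤ η)
    (hK : 0 ≤ K) (hM : 0 ≤ M) (hp : 1 ≤ pek) (hθ : ∀ sg ∈ γ, |θ sg.1| ≤ ek * η * K) (hn : γ.length ≤ nℓ) (hℓ : η * nℓ ≤ ℓ₀)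
    (hμ : |Δμ| ≤ ek * M * pek) :
    |signedSum θ γ| + |Δμ| ≤ (ℓ₀ * K + M) * ek * pek ^ 2 := by
  have h1 : |signedSum θ γ| ≤ γ.length * (ek * η * K) := abs_signedSum_le θ γ hθ
  have hlen : (γ.length : ℝ) ≤ nℓ := by exact_mod_cast hn
  have h2 : (γ.length : ℝ) * (ek * η * K) ≤ nℓ * (ek * η * K) :=
    mul_le_mul_of_nonneg_right hlen (mul_nonneg (mul_nonneg hek hη) hK)
  have h3 : (nℓ : ℝ) * (ek * η * K) = (η * nℓ) * K * ek := by ring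
  have h4 : (η * nℓ) * K * ek ≤ ℓ₀ * K * ek := mul_le_mul_of_nonneg_right (mul_le_mul_of_nonneg_right hℓ hK) hek
  have hp0 : 0 ≤ pek := zero_le_one.trans hp
  have hp2 : 1 ≤ pek ^ 2 := by nlinarith
  have h5 : ℓ₀ * K * ek ≤ ℓ₀ * K * ek * pek ^ 2 := by
    have hKe : 0 ≤ ℓ₀ * K * ek := by nlinarith [mul_nonneg hη (Nat.cast_nonneg nℓ), mul_nonneg hK hek]
    calc ℓ₀ * K * ek = ℓ₀ * K * ek * 1 := (mul_one _).symm
      _ ≤ ℓ₀ * K * ek * pek ^ 2 := mul_le_mul_of_nonneg_left hp2 hKe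
  have h6 : ek * M * pek ≤ M * ek * pek ^ 2 := by
    have : 0 ≤ ek * M * pek := mul_nonneg (mul_nonneg hek hM) hp0
    nlinarith
  nlinarith

/-- **mechanism + size**: under the hypotheses of `passage593_mechanism` and `passage593_datum` (per-bond smallness on `line b`,
`|μ(b₊) − μ(b₋)| ≤ e_kM·p(e_k)`), `|D_{ū′}ψ′(b)| ≤ |D_ūψ(b)| + (ℓ₀K + M)·e_k·p(e_k)²·|ψ(b₊)|` — exactly the input shape of p02 g6's
`passage593_small`/`passage593_large` with `δ = (ℓ₀K + M)e_kp(e_k)²`. [cite: BalabanImbrieJaffe1988, (5.9.3) p.296] -/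
theorem passage593_mechanism_datum (u : PBond P j → ℂ) (hu : ∀ b, ‖u b‖ = 1) (θ : PBond P j → ℝ)
    (lam : Balaban1983to89.Site P j → ℝ) (μ : Balaban1983to89.Site P j' → ℝ) (ψ : Balaban1983to89.Site P j' → ℂ)
    (base : Balaban1983to89.Site P j' → Balaban1983to89.Site P j) (line : PBond P j' → Contour P j) (b : PBond P j')
    (hline : IsPath (base b.src) (line b) (base b.tgt)) {ek η K ℓ₀ M pek : ℝ} {nℓ : ℕ} (hek : 0 ≤ ek) (hη : 0 ≤ η)
    (hK : 0 ≤ K) (hM : 0 ≤ M) (hp : 1 ≤ pek) (hθ : ∀ sg ∈ line b, |θ sg.1| ≤ ek * η * K) (hn : (line b).length ≤ nℓ)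
    (hℓ : η * nℓ ≤ ℓ₀) (hμ : |μ b.tgt - μ b.src| ≤ ek * M * pek) :
    ‖covD 1 (fun b' => transport (gaugeU lam (fun e => u e * phaseCfg θ e)) (line b'))
        (fun z => exp (((lam (base z) + μ z : ℝ) : ℂ) * I) * ψ z) b‖
      ≤ ‖covD 1 (fun b' => transport u (line b')) ψ b‖ + (ℓ₀ * K + M) * ek * pek ^ 2 * ‖ψ b.tgt‖ :=
  (passage593_mechanism u hu θ lam μ ψ base line b hline).trans (add_le_add le_rfl
    (mul_le_mul_of_nonneg_right (passage593_datum θ (line b) hek hη hK hM hp hθ hn hℓ hμ) (norm_nonneg _)))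

end Datum

/-! ## §6 (v1.1, append-only) The mechanism ON r16's TYPED BACKGROUND FORMS: (5.3.4) `u_k`, (5.6.1) `ũ_{k+1}`, (5.6.6) `ũ` -/

section TypedForms

open BIJ88Sect5StatementsPart3

/-- r16's exponential background form `(Q^{s*}_{k+1}v)·exp ie_kη[X]` has unit modulus when `Q^{s*}_{k+1}v` has.
[cite: BalabanImbrieJaffe1988, (5.3.4) p.280] -/
theorem norm_bgExp {ek η : ℝ} {Q : PBond P j → ℂ} (hQ : ∀ b, ‖Q b‖ = 1) (X : PBond P j → ℝ) (b : PBond P j) :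
    ‖bgExp ek η Q X b‖ = 1 := by
  simp only [bgExp, norm_mul, hQ b, one_mul]
  rw [mul_comm, norm_exp_ofReal_mul_I]

/-- two background forms with the SAME block part `Q^{s*}_{k+1}v` differ by the pure phase field of the bracket difference:
`(Q e^{ie_kηX₂}) = (Q e^{ie_kηX₁}) · e^{ie_kη(X₂ − X₁)}` — so (5.3.4) `u_k` (bracket `bracket534`) and (5.6.1) `ũ_{k+1}` (bracket `bracket561`)
are related by a `phaseCfg`, the «removed small fields» of p. 296 in r16's vocabulary. [cite: BalabanImbrieJaffe1988, (5.6.1) p.285] -/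
theorem bgExp_eq_mul_phaseCfg (ek η : ℝ) (Q : PBond P j → ℂ) (X₁ X₂ : PBond P j → ℝ) (b : PBond P j) :
    bgExp ek η Q X₂ b = bgExp ek η Q X₁ b * phaseCfg (fun e => ek * η * (X₂ e - X₁ e)) b := by
  simp only [bgExp, phaseCfg]
  rw [mul_assoc (Q b), ← Complex.exp_add]
  congr 2
  push_cast
  ring

/-- (5.6.6) `ũ = exp ie_kη[θ_kH_{k,loc}A^{(k)} + w₁A′]` (r16's `uSmall566`) IS a pure phase field `phaseCfg`. [cite: BalabanImbrieJaffe1988, (5.6.6) p.287] -/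
theorem uSmall566_eq_phaseCfg (ek η : ℝ) (θk HA wA : PBond P j → ℝ) (b : PBond P j) :
    uSmall566 ek η θk HA wA b = phaseCfg (fun e => ek * η * (θk e * HA e + wA e)) b := by
  simp only [uSmall566, phaseCfg, mul_comm I]

/-- (5.6.1) against (5.3.4): `ũ_{k+1} = u_k · e^{ie_kη(bracket561 − X_k)}` pointwise, for `u_k = (Q^{s*}_{k+1}v)e^{ie_kηX_k}` (r16's `bg534` is
`bgExp … (bracket534 …)` by `rfl`). [cite: BalabanImbrieJaffe1988, (5.6.1) p.285] -/
theorem uTilde561_eq_mul_phaseCfg (ek η L : ℝ) (Q : PBond P j → ℂ) (θk HA DXf Xk : PBond P j → ℝ) (b : PBond P j) :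
    uTilde561 ek η L Q θk HA DXf b
      = bgExp ek η Q Xk b * phaseCfg (fun e => ek * η * (bracket561 L θk HA DXf e - Xk e)) b :=
  bgExp_eq_mul_phaseCfg ek η Q Xk _ b

/-- the mechanism WITHOUT an explicit gauge transformation (λ = 0): `u′ = u·e^{iθ}`, `ψ′ = e^{iμ}ψ` ⇒
`|D_{ū′}ψ′(b)| ≤ |D_ūψ(b)| + (|Σ_{line b}±θ| + |μ(b₊) − μ(b₋)|)·|ψ(b₊)|`. [cite: BalabanImbrieJaffe1988, (5.9.3) p.296] -/
theorem passage593_mechanism₀ (u : PBond P j → ℂ) (hu : ∀ b, ‖u b‖ = 1) (θ : PBond P j → ℝ)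
    (μ : Balaban1983to89.Site P j' → ℝ) (ψ : Balaban1983to89.Site P j' → ℂ)
    (base : Balaban1983to89.Site P j' → Balaban1983to89.Site P j) (line : PBond P j' → Contour P j) (b : PBond P j')
    (hline : IsPath (base b.src) (line b) (base b.tgt)) :
    ‖covD 1 (fun b' => transport (fun e => u e * phaseCfg θ e) (line b')) (fun z => exp (((μ z : ℝ) : ℂ) * I) * ψ z) b‖
      ≤ ‖covD 1 (fun b' => transport u (line b')) ψ b‖ + (|signedSum θ (line b)| + |μ b.tgt - μ b.src|) * ‖ψ b.tgt‖ := by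
  have h := passage593_mechanism u hu θ (fun _ => (0 : ℝ)) μ ψ base line b hline
  simpa only [BIJ88Regularity286.gaugeU_zero, zero_add] using h

/-- **THE PASSAGE ON r16's TYPED FORMS**: old fine field `u_k = (Q^{s*}_{k+1}v)e^{ie_kηX_k}` ((5.3.4), `bgExp`, with `|Q^{s*}_{k+1}v| = 1`),
new fine field `ũ_{k+1} = uTilde561 e_k η L (Q^{s*}_{k+1}v) θ_k (H_{k,loc}A^{(k)}) (𝒟^η_{k+1,loc}∂*Q^{e*}_{k+1}f)` ((5.6.1)), block field rotated
by a residual `μ`: `|D_{\overline{ũ_{k+1}}}(e^{iμ}ψ)(b)| ≤ |D_{ū_k}ψ(b)| + (|Σ_{line b} ±e_kη[bracket561 − X_k]| + |μ(b₊) − μ(b₋)|)·|ψ(b₊)|` — the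
«removed small fields» are IDENTIFIED as `e_kη·[(1 − θ_k)H_{k,loc}A^{(k)} − L^{−2}𝒟^η_{k+1,loc}∂*Q^{e*}_{k+1}f − X_k]` per bond.
[cite: BalabanImbrieJaffe1988, (5.9.3) p.296] -/
theorem passage593_mechanism_typed {ek η L : ℝ} {Q : PBond P j → ℂ} (hQ : ∀ b, ‖Q b‖ = 1)
    (θk HA DXf Xk : PBond P j → ℝ) (μ : Balaban1983to89.Site P j' → ℝ) (ψ : Balaban1983to89.Site P j' → ℂ)
    (base : Balaban1983to89.Site P j' → Balaban1983to89.Site P j) (line : PBond P j' → Contour P j) (b : PBond P j')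
    (hline : IsPath (base b.src) (line b) (base b.tgt)) :
    ‖covD 1 (fun b' => transport (uTilde561 ek η L Q θk HA DXf) (line b')) (fun z => exp (((μ z : ℝ) : ℂ) * I) * ψ z) b‖
      ≤ ‖covD 1 (fun b' => transport (bgExp ek η Q Xk) (line b')) ψ b‖
        + (|signedSum (fun e => ek * η * (bracket561 L θk HA DXf e - Xk e)) (line b)| + |μ b.tgt - μ b.src|) * ‖ψ b.tgt‖ := by
  have hfun : uTilde561 ek η L Q θk HA DXf
      = fun e => bgExp ek η Q Xk e * phaseCfg (fun e => ek * η * (bracket561 L θk HA DXf e - Xk e)) e :=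
    funext fun e => uTilde561_eq_mul_phaseCfg ek η L Q θk HA DXf Xk e
  rw [hfun]
  exact passage593_mechanism₀ (bgExp ek η Q Xk) (norm_bgExp hQ Xk) _ μ ψ base line b hline

/-- per-bond SIZE of the removed fields in r16's vocabulary: with `0 ≤ θ_k ≤ 1`, `|H_{k,loc}A^{(k)}| ≤ K₁p(e_k)` ((5.9.4) + (2.5)),
`|𝒟^η_{k+1,loc}∂*Q^{e*}_{k+1}f| ≤ K₂p(e_k)` ((5.9.1) + boundedness of 𝒟), `|X_k| ≤ K₃p(e_k)` ((5.3.1) + (5.9.1) in (5.3.4)) on a bond `e`: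
`|e_kη[bracket561 − X_k](e)| ≤ e_kη(K₁ + L^{−2}K₂ + K₃)p(e_k)`. [cite: BalabanImbrieJaffe1988, (5.6.1) p.285] -/
theorem abs_removedPhase_le {ek η L pek K₁ K₂ K₃ : ℝ} (hek : 0 ≤ ek) (hη : 0 ≤ η) {θk HA DXf Xk : PBond P j → ℝ}
    {e : PBond P j} (hθ0 : 0 ≤ θk e) (hθ1 : θk e ≤ 1) (hHA : |HA e| ≤ K₁ * pek) (hDXf : |DXf e| ≤ K₂ * pek)
    (hXk : |Xk e| ≤ K₃ * pek) :
    |ek * η * (bracket561 L θk HA DXf e - Xk e)| ≤ ek * η * (K₁ + L⁻¹ ^ 2 * K₂ + K₃) * pek := by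
  have hb : |bracket561 L θk HA DXf e - Xk e| ≤ (K₁ + L⁻¹ ^ 2 * K₂ + K₃) * pek := by
    simp only [bracket561]
    have h1 : |(1 - θk e) * HA e| ≤ K₁ * pek := by
      rw [abs_mul, abs_of_nonneg (by linarith)]
      calc (1 - θk e) * |HA e| ≤ 1 * |HA e| := mul_le_mul_of_nonneg_right (by linarith) (abs_nonneg _)
        _ ≤ K₁ * pek := by rw [one_mul]; exact hHA
    have h2 : |L⁻¹ ^ 2 * DXf e| ≤ L⁻¹ ^ 2 * (K₂ * pek) := by
      rw [abs_mul, abs_of_nonneg (sq_nonneg _)]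
      exact mul_le_mul_of_nonneg_left hDXf (sq_nonneg _)
    calc |(1 - θk e) * HA e - L⁻¹ ^ 2 * DXf e - Xk e|
        ≤ |(1 - θk e) * HA e - L⁻¹ ^ 2 * DXf e| + |Xk e| := abs_sub _ _
      _ ≤ (|(1 - θk e) * HA e| + |L⁻¹ ^ 2 * DXf e|) + |Xk e| := add_le_add (abs_sub _ _) le_rfl
      _ ≤ (K₁ * pek + L⁻¹ ^ 2 * (K₂ * pek)) + K₃ * pek := add_le_add (add_le_add h1 h2) hXk
      _ = (K₁ + L⁻¹ ^ 2 * K₂ + K₃) * pek := by ring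
  rw [abs_mul, abs_of_nonneg (mul_nonneg hek hη), mul_assoc (ek * η)]
  exact mul_le_mul_of_nonneg_left hb (mul_nonneg hek hη)

/-- the datum with a `p(e_k)`-proportional per-bond bound: `|θ| ≤ e_kηK·p(e_k)` on the `≤ n_ℓ` line bonds, `η·n_ℓ ≤ ℓ₀`,
`|Δμ| ≤ e_kM·p(e_k)`, `p(e_k) ≥ 1` ⇒ `|Σ±θ| + |Δμ| ≤ (ℓ₀K + M)·e_k·p(e_k)²`. [cite: BalabanImbrieJaffe1988, (5.9.3) p.296] -/
theorem passage593_datum' (θ : PBond P j → ℝ) (γ : Contour P j) {ek η K ℓ₀ M pek Δμ : ℝ} {nℓ : ℕ} (hek : 0 ≤ ek) (hη : 0 ≤ η)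
    (hK : 0 ≤ K) (hM : 0 ≤ M) (hp : 1 ≤ pek) (hθ : ∀ sg ∈ γ, |θ sg.1| ≤ ek * η * K * pek) (hn : γ.length ≤ nℓ)
    (hℓ : η * nℓ ≤ ℓ₀) (hμ : |Δμ| ≤ ek * M * pek) :
    |signedSum θ γ| + |Δμ| ≤ (ℓ₀ * K + M) * ek * pek ^ 2 := by
  have hp0 : 0 ≤ pek := zero_le_one.trans hp
  have h1 : |signedSum θ γ| ≤ γ.length * (ek * η * K * pek) := abs_signedSum_le θ γ hθ
  have hlen : (γ.length : ℝ) ≤ nℓ := by exact_mod_cast hn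
  have h2 : (γ.length : ℝ) * (ek * η * K * pek) ≤ nℓ * (ek * η * K * pek) :=
    mul_le_mul_of_nonneg_right hlen (mul_nonneg (mul_nonneg (mul_nonneg hek hη) hK) hp0)
  have h4 : (nℓ : ℝ) * (ek * η * K * pek) ≤ ℓ₀ * K * ek * pek := by
    have : (nℓ : ℝ) * (ek * η * K * pek) = (η * nℓ) * (K * ek * pek) := by ring
    rw [this]
    calc (η * nℓ) * (K * ek * pek) ≤ ℓ₀ * (K * ek * pek) :=
        mul_le_mul_of_nonneg_right hℓ (mul_nonneg (mul_nonneg hK hek) hp0)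
      _ = ℓ₀ * K * ek * pek := by ring
  have hℓ0 : 0 ≤ ℓ₀ := le_trans (mul_nonneg hη (Nat.cast_nonneg nℓ)) hℓ
  have h5 : ℓ₀ * K * ek * pek ≤ ℓ₀ * K * ek * pek ^ 2 := by
    have h0 : 0 ≤ ℓ₀ * K * ek * pek := mul_nonneg (mul_nonneg (mul_nonneg hℓ0 hK) hek) hp0
    nlinarith
  have h6 : ek * M * pek ≤ M * ek * pek ^ 2 := by
    have : 0 ≤ ek * M * pek := mul_nonneg (mul_nonneg hek hM) hp0
    nlinarith
  nlinarith

end TypedForms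

end Literature.MathematicalPhysics.QuantumFieldTheory.BalabanImbrieJaffe1984to88.BIJ88PassageMechanism593
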